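import Summits.ValiantsHypothesis.ValiantsHypothesis.Theorems.BarrierLeverPartitionMinorsSubsetSumFrobenius
import Summits.ValiantsHypothesis.ValiantsHypothesis.Theorems.BarrierLeverPartitionMinorsHitByVPSplittableFaces
import Summits.ValiantsHypothesis.ValiantsHypothesis.Theorems.BarrierLeverPartitionMinorsHitByVPOrProjections

/-!
# Route BarrierLever — item `PartitionMinorsHitByVP` (stmt-ValiantsHypothesis-19717):
# ALL row families × FACE column families are hit (unconditional), and the mirror

Helper file (`--supports stmt-ValiantsHypothesis-19717`; cell valiant-natproofs, rung V4, 𝒟-side door (c),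
prover seat val-np-p1, gen 10). Closes NO item; definition-free glue of

* ENGINE v3 `SubsetSum.exists_det_ne_zero_of_injective` (`…SubsetSumFrobenius`, this seat): for EVERY
  injective row family `u : (Fin κ → Bool) → Finset (Fin h)` some numeric table `Γ₀, Γ` makes the subset-sum
  multilinear Vandermonde `[∏_{c : W c} (Γ₀ c + Σ_{k ∈ u i} Γ k c)]_{i, W}` nonsingular (reduction mod 2:
  Frobenius table ⇒ Vandermonde of code polynomials);
* the DOOR `AdditiveDoor.partitionMinor_hit_of_additive_mem` (val-np-p6 g3) and its `x ↔ y` symmetry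
  `AdditiveDoor.partitionMinor_hit_symm`.

**Theorem (`partitionMinor_hit_face`).** `h ≥ 2`. Let the columns form a `κ`-dimensional FACE
`[W₀, W₀ ⊔ T]` of the Boolean lattice `2^{Fin h}` (`w W = W₀ ∪ T(W)`, `T : Fin κ ↪ Fin h`, `W₀` off the block,
`W` over ALL bit-vectors) and let the `2^κ` rows be ANY injective family `u`. Then the layout `(u, w)` is hit
inside `SmallCircuits ℂ (h+h) 5`: `∃ f`, `det [coeff_{x^{u i} y^{w j}} f] ≠ 0`. Forms: bit-vector-indexed,
`Fin r`-indexed along a bijection `e : Fin r ≃ (Fin κ → Bool)` (`…_fin`, the item's quantifier shape), and the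
purely combinatorial INTERVAL form (`partitionMinor_hit_allRows_faceColumns`: `w` injective with every
`w j ∈ [W₀, W₀ ∪ T']`, `W₀ ∩ T' = ∅`, `r = 2^{|T'|}`); mirrors `partitionMinor_hit_faceRows_allColumns[_fin]`
(rows a face, columns ANY injective family).

This is the class «ALL ROWS × FACE COLUMNS» of the cell's owner table (MAP-next-round 2026-08-27 08:35Z), until now
conditional on cube halving (`partitionMinor_hit_face_of_cubeHalving`, whose hypothesis is false from `κ = 6`):
an UNCONDITIONAL class of item 19717 with `r = 2^κ` for every `κ ≤ h` and NO structure on the row side.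
WHAT THIS IS NOT: the column side must be a full face (or, mirrored, the row side); item 19717 (all injective
layouts) stays open; nothing on CPM (20172/20195), crux 14610 or VP vs VNP.
-/

set_option linter.dupNamespace false

namespace Summit.ValiantsHypothesis.ValiantsHypothesis.Theorems.BarrierLever.SubsetSum

open Finset MvPolynomial Literature.Barriers.ValiantsHypothesis
open Summit.ValiantsHypothesis.ValiantsHypothesis.Theorems.BarrierLever.AdditiveDoor
  (partitionMinor_hit_of_additive_mem partitionMinor_hit_symm)

noncomputable section

variable {h : ℕ}

/-! ## 1. All rows × face columns -/

/-- **ALL rows × FACE columns are hit** (bit-vector-indexed form): `u` any injective family of `2^κ` row sets,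
columns the face `W ↦ W₀ ∪ T(W)`. -/
theorem partitionMinor_hit_face (hh : 2 ≤ h) {κ : ℕ}
    (u : (Fin κ → Bool) → Finset (Fin h)) (hu : Function.Injective u)
    (T : Fin κ ↪ Fin h) (W₀ : Finset (Fin h)) (hW₀ : ∀ c, T c ∉ W₀) :
    ∃ f ∈ SmallCircuits ℂ (h + h) 5,
      (Matrix.of fun i j : Fin κ → Bool => MvPolynomial.coeff
        (∑ a ∈ u i, Finsupp.single (Fin.castAdd h a) 1 +
          ∑ c ∈ W₀ ∪ (univ.filter fun c => j c).map T, Finsupp.single (Fin.natAdd h c) 1) f).det ≠ 0 := by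
  obtain ⟨Γ₀, Γ, hdet⟩ := exists_det_ne_zero_of_injective κ u hu
  refine partitionMinor_hit_of_additive_mem h hh u (fun j => W₀ ∪ (univ.filter fun c => j c).map T)
    (Function.extend T Γ₀ fun _ => 1) (fun k => Function.extend T (Γ k) fun _ => 0) ?_
  have hmat : (Matrix.of fun i j : Fin κ → Bool => ∏ c ∈ W₀ ∪ (univ.filter fun c => j c).map T,
        (Function.extend T Γ₀ (fun _ => (1 : ℂ)) c +
          ∑ k ∈ u i, Function.extend T (Γ k) (fun _ => (0 : ℂ)) c)) =
      Matrix.of fun i j : Fin κ → Bool => ∏ c : Fin κ, if j c then (Γ₀ c + ∑ k ∈ u i, Γ k c) else 1 := by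
    ext i j
    exact prod_face_extend T W₀ hW₀ Γ₀ Γ (u i) j
  rw [hmat]
  exact hdet

/-- **ALL rows × FACE columns are hit** (`Fin r`-indexed form, the item's quantifier shape): rows
`u : Fin r → Finset (Fin h)` injective (nothing else), columns `w j = W₀ ∪ T(e j)` along a bijection
`e : Fin r ≃ (Fin κ → Bool)`. -/
theorem partitionMinor_hit_face_fin (hh : 2 ≤ h) {κ r : ℕ} (e : Fin r ≃ (Fin κ → Bool))
    (u w : Fin r → Finset (Fin h)) (hu : Function.Injective u)
    (T : Fin κ ↪ Fin h) (W₀ : Finset (Fin h)) (hW₀ : ∀ c, T c ∉ W₀)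
    (hw : ∀ j, w j = W₀ ∪ (univ.filter fun c => e j c).map T) :
    ∃ f ∈ SmallCircuits ℂ (h + h) 5,
      (Matrix.of fun i j : Fin r => MvPolynomial.coeff
        (∑ a ∈ u i, Finsupp.single (Fin.castAdd h a) 1 +
          ∑ c ∈ w j, Finsupp.single (Fin.natAdd h c) 1) f).det ≠ 0 := by
  have hu' : Function.Injective (fun i : Fin κ → Bool => u (e.symm i)) :=
    fun i j hij => e.symm.injective (hu hij)
  obtain ⟨f, hf, hdet⟩ := partitionMinor_hit_face hh (fun i => u (e.symm i)) hu' T W₀ hW₀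
  refine ⟨f, hf, ?_⟩
  have hmat : (Matrix.of fun i j : Fin r => MvPolynomial.coeff
        (∑ a ∈ u i, Finsupp.single (Fin.castAdd h a) 1 +
          ∑ c ∈ w j, Finsupp.single (Fin.natAdd h c) 1) f) =
      (Matrix.of fun i j : Fin κ → Bool => MvPolynomial.coeff
        (∑ a ∈ u (e.symm i), Finsupp.single (Fin.castAdd h a) 1 +
          ∑ c ∈ W₀ ∪ (univ.filter fun c => j c).map T, Finsupp.single (Fin.natAdd h c) 1) f).submatrix
        e e := by
    ext i j
    simp [Matrix.submatrix_apply, hw j]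
  rw [hmat, Matrix.det_submatrix_equiv_self]
  exact hdet

/-- **ALL rows × FACE columns are hit** (combinatorial INTERVAL form): `r = 2^{|T'|}` injective rows `u`
(nothing else), injective columns `w` all lying in the interval `[W₀, W₀ ∪ T']` with `W₀ ∩ T' = ∅` — so the
columns are exactly the face. -/
theorem partitionMinor_hit_allRows_faceColumns (hh : 2 ≤ h) {r : ℕ} (u w : Fin r → Finset (Fin h))
    (hu : Function.Injective u) (hw : Function.Injective w) (W₀ T' : Finset (Fin h))
    (hdisj : Disjoint W₀ T') (hface : ∀ j, W₀ ⊆ w j ∧ w j ⊆ W₀ ∪ T') (hr : r = 2 ^ T'.card) :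
    ∃ f ∈ SmallCircuits ℂ (h + h) 5,
      (Matrix.of fun i j : Fin r => MvPolynomial.coeff
        (∑ a ∈ u i, Finsupp.single (Fin.castAdd h a) 1 +
          ∑ c ∈ w j, Finsupp.single (Fin.natAdd h c) 1) f).det ≠ 0 := by
  -- enumerate the block `T'`
  set κ := T'.card with hκ
  let T : Fin κ ↪ Fin h := (T'.orderEmbOfFin rfl).toEmbedding
  have hT : ∀ c, T c ∈ T' := fun c => T'.orderEmbOfFin_mem rfl c
  have hW₀ : ∀ c, T c ∉ W₀ := fun c hc => Finset.disjoint_left.mp hdisj hc (hT c)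
  -- the bit-vector of a column
  let e' : Fin r → (Fin κ → Bool) := fun j c => decide (T c ∈ w j)
  have hwj : ∀ j, w j = W₀ ∪ (univ.filter fun c => e' j c).map T := by
    intro j
    ext x
    constructor
    · intro hx
      rcases Finset.mem_union.mp ((hface j).2 hx) with hW | hxT
      · exact Finset.mem_union_left _ hW
      · refine Finset.mem_union_right _ ?_
        have hx' : x ∈ Set.range (T'.orderEmbOfFin rfl) := by
          rw [Finset.range_orderEmbOfFin]; exact hxT
        obtain ⟨c, rfl⟩ := hx'
        have hx2 : T c ∈ w j := hx
        exact Finset.mem_map.mpr ⟨c, Finset.mem_filter.mpr ⟨Finset.mem_univ _, by simp [e', hx2]⟩, rfl⟩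
    · intro hx
      rcases Finset.mem_union.mp hx with hW | hmap
      · exact (hface j).1 hW
      · obtain ⟨c, hc, rfl⟩ := Finset.mem_map.mp hmap
        have := (Finset.mem_filter.mp hc).2
        simpa [e'] using this
  have he' : Function.Injective e' := fun j j' hjj' => hw (by rw [hwj j, hwj j', hjj'])
  have hbij : Function.Bijective e' := by
    refine (Fintype.bijective_iff_injective_and_card e').mpr ⟨he', ?_⟩
    simp [hr]
  exact partitionMinor_hit_face_fin hh (Equiv.ofBijective e' hbij) u w hu T W₀ hW₀ hwj

/-! ## 2. The mirror: face rows × all columns -/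

/-- **FACE rows × ALL columns are hit** (bit-vector-indexed form, `x ↔ y` mirror). -/
theorem partitionMinor_hit_faceRows_allColumns (hh : 2 ≤ h) {κ : ℕ}
    (w : (Fin κ → Bool) → Finset (Fin h)) (hw : Function.Injective w)
    (T : Fin κ ↪ Fin h) (U₀ : Finset (Fin h)) (hU₀ : ∀ c, T c ∉ U₀) :
    ∃ f ∈ SmallCircuits ℂ (h + h) 5,
      (Matrix.of fun i j : Fin κ → Bool => MvPolynomial.coeff
        (∑ a ∈ U₀ ∪ (univ.filter fun c => i c).map T, Finsupp.single (Fin.castAdd h a) 1 +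
          ∑ c ∈ w j, Finsupp.single (Fin.natAdd h c) 1) f).det ≠ 0 :=
  partitionMinor_hit_symm h 5 (fun i : Fin κ → Bool => U₀ ∪ (univ.filter fun c => i c).map T) w
    (partitionMinor_hit_face hh w hw T U₀ hU₀)

/-- **FACE rows × ALL columns are hit** (combinatorial INTERVAL form, `x ↔ y` mirror): injective columns `w`
(nothing else), injective rows `u` all in the interval `[U₀, U₀ ∪ T']`, `U₀ ∩ T' = ∅`, `r = 2^{|T'|}`. -/
theorem partitionMinor_hit_faceRows_allColumns_fin (hh : 2 ≤ h) {r : ℕ} (u w : Fin r → Finset (Fin h))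
    (hu : Function.Injective u) (hw : Function.Injective w) (U₀ T' : Finset (Fin h))
    (hdisj : Disjoint U₀ T') (hface : ∀ i, U₀ ⊆ u i ∧ u i ⊆ U₀ ∪ T') (hr : r = 2 ^ T'.card) :
    ∃ f ∈ SmallCircuits ℂ (h + h) 5,
      (Matrix.of fun i j : Fin r => MvPolynomial.coeff
        (∑ a ∈ u i, Finsupp.single (Fin.castAdd h a) 1 +
          ∑ c ∈ w j, Finsupp.single (Fin.natAdd h c) 1) f).det ≠ 0 :=
  partitionMinor_hit_symm h 5 u w
    (partitionMinor_hit_allRows_faceColumns hh w u hw hu U₀ T' hdisj hface hr)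

end

end Summit.ValiantsHypothesis.ValiantsHypothesis.Theorems.BarrierLever.SubsetSum
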